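import Literature.MathematicalPhysics.QuantumFieldTheory.Balaban1983to89.T4MatchingClosureRem

/-!
# `Balaban1983to89.T4MatchingClosureFed` — the node-U5 closure FED: the remnant rates of `ReindexedBudget` obtained BY
BOOKKEEPING from per-step two-summand remnant budgets and typed cube counts (cell `pub-balaban`, T4-DAG v11 §5 rows
T4-U5.E-CLOSE*-REM / -REMW / T4-U5.E-c-HLOC°; journal self-row T4-U5.E-CLOSE*-FED; record `t4/T4-EST-U5.md` v1.9 §0 (n))

HONEST FRAMING (cell `pub-balaban`, T4-DAG PAGE 1).  The cell's T4 target is the existence AND uniqueness of the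
continuum limit of Bałaban's unit-scale averaged loop expectations on a finite torus — strictly beyond ultraviolet
stability ([Balaban1989LargeFieldII] Thm 1 p. 355); it is NOT the Yang–Mills mass gap and NOT the Clay problem.  This
module is KERNEL BOOKKEEPING ONLY (finite sums of real numbers; 0 estimates).  The closure theorems of
`T4MatchingClosureRem` §7 (`hybridNE7_closure_remnantW`, `stringHybridNE7_closure_remnantW`; unit `b2b-balaban-pv02`
gen 8, p181923) consume ONE budget binder
`hTB : ReindexedBudget … (u′ + remnantOld remOld Λ C C′) s₂ c₀ (r′ + C_y·remnantYoungW θ Λ C W) s` in which the two-run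
discrepancy of the REMNANT leaves (the exponentiated expansions met at the recent steps `j ∈ [jlog_C K, K]`) is already
written as two RATES per unit volume: the old-born part `remnantOld` inside the UV-radius rate (field `uv_radius`) and
the young part `C_y·remnantYoungW` inside the recent-remainder rate (field `recent_remainder`).  A PRODUCER of that
discrepancy, however, delivers it PER STEP and PER ANCHORING CUBE: at each step `j` of the window the remnant-leaf radii
of a term have sum `≤ E·(r_j·#Q_y(j) + 2σ₀·#Q_o(j))` — a RATE `r_j` on the cubes `Q_y(j)` anchoring YOUNG discrepant
polymers, twice the banked SIZE `σ₀ = ρ^{A(K)}` on the cubes `Q_o(j)` anchoring OLD-born ones (this is the conclusion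
SHAPE of unit `b2b-balaban-pv05` gen 10's `T4TwoRunRateAssembly.discrepancy_budget_le_young_add_old` /
`leafSum_remnant_radius_le_young_add_old`, proposal p182873 — cited here BY SHAPE only: that module is not imported and
nothing of it is used; every inequality below is a BINDER).  Between the two sits the cube count which the booking
convention leaves to the consumer (`T4RemnantBooking`, module docstring, NORMALISATION: «`remOld j A` is PER SCALE-`j`
CUBE and the consumer supplies the cube count `Λ^{K−j}`» — a cell convention, quoted from a tree docstring, not from
print).  This module types that count (`#Q(j) ≤ vol·Λ^{K−j}`) and the young rate profile (`r_j ≤ C_r·θ^j·θ^{−W(K)}`: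
a young sub-history is created within the allowance `W(K)` before `j`), and PROVES the window arithmetic
`Σ_{j ∈ [jlog_C K, K]} rad_j ≤ vol·((E·C_r)·remnantYoungW θ Λ C W K) + vol·remnantOld (fun _ n ↦ 2E·ρⁿ) Λ C C′ K`
(§1, with its equality case), the producer-facing budget shape in which the per-term REMNANT radius is a separate piece
(§2, `RemnantSplitBudget`, and its repackaging as a `ReindexedBudget`), the per-term feed from per-step data (§3,
`StepBudget`), and the closure with these inputs in place of `hTB` (§4).  Nothing else.

WHAT IS FED AND WHAT IS NOT (no over-claim).  FED = the ARITHMETIC from «per step, per anchoring cube» to «per cutoff,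
per unit volume»: after §4 the remnant clause of node U5 reads, per good term and per window step, as the four binders
of `StepBudget` (rate profile, two cube counts, the two-summand step budget) with ONE amplitude `E ≥ 0` and ONE rate
constant `C_r`, uniform in the term and the cutoff — and the old profile is then AUTOMATICALLY the saturating
`RemnantAgeBound (fun _ n ↦ 2E·ρⁿ) (2E) ρ` (`T4RemnantBooking.remnantAgeBound_saturated`; the same profile as pv05's
`remnantAgeBound_oldSummand` with `E = A_F·e^{b+τc₁}·K₀`, by shape).  NOT FED (the producers' obligations, NOT PRINTED,
proved nowhere in the tree): that Bałaban's remnant activities obey the young RATE / old SIZE binders at the activity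
level (cell nodes NE-R1 two-run half / NE2⁺-LF / U5a for the rate; NE7b-rem for the size — print's one-run bounds
[Balaban1989LargeFieldII] (1.97)–(1.100) p. 390 are the age-free case, cited as LOCATIONS only), that the sub-histories'
lifetimes sit inside the allowance `W(K)` (record `t4/T4-EST-U5E-rem.md` §4 Lemma Y — cell analysis; its ARITHMETIC is
the tree's `T4BankAgeYoung`, unit pv25 gen 6, whose canonical window `youngWindow` discharges `hW` by
`(T4BankAgeYoung.polylogWindow_youngWindow …).sublinear` — a one-line composition kernel-checked in the lineage's scratch
probe and deliberately NOT imported here), and the seven non-remnant fields of the budget (rows T4-U5.E-b / E-b-R1 /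
E-c).  The uniformity of `E`, `C_r` in the cutoff is itself a binder-level assumption: print's constants are uniform in
`k` ([Balaban1989LargeFieldII] p. 355, Theorem 1 — location), the two-run ones are NOT PRINTED.

ABSOLUTE RULE.  Nothing of [Balaban1989LargeFieldII] is asserted; no `[cite:]` tag; page numbers are LOCATIONS.  Every
declaration is [folklore] bookkeeping over `T4MatchingClosureRem` §5–§7, `T4MatchingClosure` §4 and `T4RemnantBooking`
§1/§5.  Rung-(B)+1 value = the user-facing binder list of node U5 with the remnant clause resolved to per-step,
per-cube binders; NOT an estimate, NOT summit progress.  Unit `b2b-balaban-pv02` gen 11 (journal CLAIM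
T4-U5.E-CLOSE*-FED 2026-08-19T03:34:29Z).
-/

open Finset

namespace Literature.MathematicalPhysics.QuantumFieldTheory.Balaban1983to89.T4MatchingClosureFed

open T4CauchySum T4GoodClassBudget T4HistoryPeeling T4MatchingAssembly T4MatchingClosure T4RemnantBooking
  T4MatchingClosureRem

/-! ## §1 Window arithmetic: per-step two-summand budgets and cube counts ⇒ the two remnant rates -/

section Window

variable {K : ℕ} {vol Λ C C' θ ρ E Cr : ℝ} {W : ℕ → ℕ} {rad ry Qy Qo : ℕ → ℝ}

/-- ONE STEP, YOUNG SUMMAND: a rate `r_j ≤ C_r·θ^j·θ^{−W(K)}` paid on `#Q_y(j) ≤ vol·Λ^{K−j}` cubes with amplitude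
`E ≥ 0` is at most `vol·(E·C_r)·(θ^{−W(K)}·θ^j·Λ^{K−j})` — the step-`j` summand of `vol·(E·C_r)·remnantYoungW`.
[folklore] -/
theorem young_step_le (hE : 0 ≤ E) {j : ℕ} (hry0 : 0 ≤ ry j) (hry : ry j ≤ Cr * θ ^ j * θ⁻¹ ^ W K)
    (hQy0 : 0 ≤ Qy j) (hQy : Qy j ≤ vol * Λ ^ (K - j)) :
    E * (ry j * Qy j) ≤ vol * ((E * Cr) * (θ⁻¹ ^ W K * (θ ^ j * Λ ^ (K - j)))) := by
  have h1 : ry j * Qy j ≤ (Cr * θ ^ j * θ⁻¹ ^ W K) * (vol * Λ ^ (K - j)) :=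
    mul_le_mul hry hQy hQy0 (hry0.trans hry)
  calc E * (ry j * Qy j) ≤ E * ((Cr * θ ^ j * θ⁻¹ ^ W K) * (vol * Λ ^ (K - j))) :=
        mul_le_mul_of_nonneg_left h1 hE
    _ = vol * ((E * Cr) * (θ⁻¹ ^ W K * (θ ^ j * Λ ^ (K - j)))) := by ring

/-- ONE STEP, OLD SUMMAND: twice the banked size `σ₀ = ρ^{A(K)}` paid on `#Q_o(j) ≤ vol·Λ^{K−j}` cubes with amplitude
`E ≥ 0` (`ρ ≥ 0`) is at most `vol·Λ^{K−j}·(2E·ρ^{A(K)})` — the step-`j` summand of `vol·remnantOld (fun _ n ↦ 2Eρⁿ)`.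
[folklore] -/
theorem old_step_le (hE : 0 ≤ E) (hρ : 0 ≤ ρ) {j : ℕ} (hQo : Qo j ≤ vol * Λ ^ (K - j)) :
    E * (2 * ρ ^ ageCut C' K * Qo j) ≤ vol * (Λ ^ (K - j) * (2 * E * ρ ^ ageCut C' K)) := by
  have h0 : 0 ≤ 2 * E * ρ ^ ageCut C' K := by positivity
  calc E * (2 * ρ ^ ageCut C' K * Qo j) = (2 * E * ρ ^ ageCut C' K) * Qo j := by ring
    _ ≤ (2 * E * ρ ^ ageCut C' K) * (vol * Λ ^ (K - j)) := mul_le_mul_of_nonneg_left hQo h0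
    _ = vol * (Λ ^ (K - j) * (2 * E * ρ ^ ageCut C' K)) := by ring

/-- The window sum of the step majorants IS `vol·((E·C_r)·remnantYoungW θ Λ C W K) + vol·remnantOld (2Eρ^·) Λ C C′ K`
(definitions `T4MatchingClosureRem.remnantYoungW` / `remnantOld`, `T4GoodClassBudget.windowSum`). [folklore] -/
theorem windowBudget_eq :
    ∑ j ∈ Icc (jlogOf C K) K, (vol * ((E * Cr) * (θ⁻¹ ^ W K * (θ ^ j * Λ ^ (K - j)))) +
        vol * (Λ ^ (K - j) * (2 * E * ρ ^ ageCut C' K))) =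
      vol * ((E * Cr) * remnantYoungW θ Λ C W K) + vol * remnantOld (fun _ n => 2 * E * ρ ^ n) Λ C C' K := by
  simp only [remnantYoungW, windowSum, remnantOld, Finset.mul_sum, Finset.sum_add_distrib]

/-- **THE WINDOW ARITHMETIC.**  If at every step `j ∈ [jlog_C K, K]` the remnant share `rad j` of a term obeys the
two-summand budget `rad j ≤ E·(r_j·#Q_y(j) + 2ρ^{A(K)}·#Q_o(j))` with a young rate `0 ≤ r_j ≤ C_r·θ^j·θ^{−W(K)}` and cube
counts `0 ≤ #Q_y(j) ≤ vol·Λ^{K−j}`, `#Q_o(j) ≤ vol·Λ^{K−j}` (`E, ρ ≥ 0`), then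
`Σ_j rad j ≤ vol·((E·C_r)·remnantYoungW θ Λ C W K) + vol·remnantOld (fun _ n ↦ 2Eρⁿ) Λ C C′ K` — the two remnant rates of
`T4MatchingClosureRem.hybridNE7_closure_remnantW` with `C_y = E·C_r`, `remOld = (fun _ n ↦ 2Eρⁿ)`. [folklore] -/
theorem windowBudget_le (hE : 0 ≤ E) (hρ : 0 ≤ ρ)
    (hry : ∀ j ∈ Icc (jlogOf C K) K, 0 ≤ ry j ∧ ry j ≤ Cr * θ ^ j * θ⁻¹ ^ W K)
    (hQy : ∀ j ∈ Icc (jlogOf C K) K, 0 ≤ Qy j ∧ Qy j ≤ vol * Λ ^ (K - j))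
    (hQo : ∀ j ∈ Icc (jlogOf C K) K, Qo j ≤ vol * Λ ^ (K - j))
    (hstep : ∀ j ∈ Icc (jlogOf C K) K, rad j ≤ E * (ry j * Qy j + 2 * ρ ^ ageCut C' K * Qo j)) :
    ∑ j ∈ Icc (jlogOf C K) K, rad j ≤
      vol * ((E * Cr) * remnantYoungW θ Λ C W K) + vol * remnantOld (fun _ n => 2 * E * ρ ^ n) Λ C C' K := by
  rw [← windowBudget_eq]
  refine Finset.sum_le_sum fun j hj => ?_
  have h := hstep j hj
  rw [mul_add] at h
  exact h.trans (add_le_add (young_step_le hE (hry j hj).1 (hry j hj).2 (hQy j hj).1 (hQy j hj).2)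
    (old_step_le hE hρ (hQo j hj)))

/-- TIGHTNESS: with saturated inputs (`r_j = C_r·θ^j·θ^{−W(K)}`, `#Q_y(j) = #Q_o(j) = vol·Λ^{K−j}`, the step budget an
equality) the window bound of `windowBudget_le` is an EQUALITY — the bookkeeping loses nothing. [folklore] -/
theorem windowBudget_tight :
    ∑ j ∈ Icc (jlogOf C K) K, E * ((Cr * θ ^ j * θ⁻¹ ^ W K) * (vol * Λ ^ (K - j)) +
        2 * ρ ^ ageCut C' K * (vol * Λ ^ (K - j))) =
      vol * ((E * Cr) * remnantYoungW θ Λ C W K) + vol * remnantOld (fun _ n => 2 * E * ρ ^ n) Λ C C' K := by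
  rw [← windowBudget_eq]
  exact Finset.sum_congr rfl fun j _ => by ring

/-- HYPOTHESIS SHAPE `StepBudget` — THE REMNANT CLAUSE OF ONE TERM AT ONE CUTOFF, PER STEP (NOT PRINTED; nothing
asserted): on the window `j ∈ [jlog_C K, K]`, a young RATE profile `0 ≤ r_j ≤ C_r·θ^j·θ^{−W(K)}` (a young sub-history is
created within the allowance `W(K)` before `j`), cube counts `0 ≤ #Q_y(j) ≤ vol·Λ^{K−j}` and `#Q_o(j) ≤ vol·Λ^{K−j}`
(anchoring cubes of the young / old-born discrepant polymers at step `j`; the count the booking convention of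
`T4RemnantBooking` leaves to the consumer), and the TWO-SUMMAND STEP BUDGET `rad j ≤ E·(r_j·#Q_y(j) + 2ρ^{A(K)}·#Q_o(j))`
for the term's remnant-leaf radius share `rad j` at step `j` (`A(K) = ageCut C′ K`; the conclusion shape of a per-step
producer, e.g. a leaf sum over the step-`j` remnant leaves of the term's nested ledger). [folklore] -/
structure StepBudget (C C' θ ρ E Cr vol Λ : ℝ) (W : ℕ → ℕ) (K : ℕ) (rad ry Qy Qo : ℕ → ℝ) : Prop where
  /-- young two-run rate profile at step `j` -/
  rate : ∀ j ∈ Icc (jlogOf C K) K, 0 ≤ ry j ∧ ry j ≤ Cr * θ ^ j * θ⁻¹ ^ W K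
  /-- anchoring cubes of young discrepant polymers at step `j` -/
  young_count : ∀ j ∈ Icc (jlogOf C K) K, 0 ≤ Qy j ∧ Qy j ≤ vol * Λ ^ (K - j)
  /-- anchoring cubes of old-born discrepant polymers at step `j` -/
  old_count : ∀ j ∈ Icc (jlogOf C K) K, Qo j ≤ vol * Λ ^ (K - j)
  /-- the two-summand step budget -/
  step : ∀ j ∈ Icc (jlogOf C K) K, rad j ≤ E * (ry j * Qy j + 2 * ρ ^ ageCut C' K * Qo j)

/-- A `StepBudget` sums over the window to the two remnant rates (`windowBudget_le`). [folklore] -/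
theorem StepBudget.sum_le (h : StepBudget C C' θ ρ E Cr vol Λ W K rad ry Qy Qo) (hE : 0 ≤ E) (hρ : 0 ≤ ρ) :
    ∑ j ∈ Icc (jlogOf C K) K, rad j ≤
      vol * ((E * Cr) * remnantYoungW θ Λ C W K) + vol * remnantOld (fun _ n => 2 * E * ρ ^ n) Λ C C' K :=
  windowBudget_le hE hρ h.rate h.young_count h.old_count h.step

end Window

/-! ## §2 The producer-facing budget shape: the per-term REMNANT radius as a separate piece -/

section Split

variable {ι : Type*} [DecidableEq ι] {l₀ vol : ℝ} {T : ℕ → Finset ι} {A B : ℕ → ℝ → ι → ℝ}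
  {Bad : ℕ → ℝ → Finset ι} {Cc Rr CcRec RrRec RrRem : ℕ → ℝ → ι → ℝ} {ν u s₂ c₀ r s rY rO : ℕ → ℝ}

/-- HYPOTHESIS SHAPE `RemnantSplitBudget` — `T4MatchingClosure.ReindexedBudget` WITH THE REMNANT RADIUS SPLIT OFF (NOT
PRINTED; nothing asserted).  The seven clauses of `ReindexedBudget` per good term `τ` at `(K, t)`, `|t| ≤ l₀`, except
that the per-term radius now splits THREE ways, `Rr ≤ RrRec + RrRem + vol·u K`: the recent factors' radius `RrRec`
(`≤ vol·r K`, rows T4-U5.E-b / E-c), the REMNANT leaves' radius `RrRem` (left free here — bounded per unit volume by a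
young-booked plus an old-booked rate in `RemnantSplitBudget.reindexed`, or fed from per-step data in §3), and the NE-R1
(γ) part `vol·u K`.  `u`, `r` are the rates WITHOUT remnants (the `u′`, `r′` of `T4MatchingClosureRem`). [folklore] -/
structure RemnantSplitBudget {ι : Type*} [DecidableEq ι] (l₀ vol : ℝ) (T : ℕ → Finset ι) (A B : ℕ → ℝ → ι → ℝ)
    (Bad : ℕ → ℝ → Finset ι) (Cc Rr CcRec RrRec RrRem : ℕ → ℝ → ι → ℝ) (ν u s₂ c₀ r s : ℕ → ℝ) : Prop where
  /-- good terms of run A are non-negative (I-2) -/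
  nonneg : ∀ K t, |t| ≤ l₀ → ∀ τ ∈ T K \ Bad K t, 0 ≤ A K t τ
  /-- lower half of the per-term sandwich -/
  lower : ∀ K t, |t| ≤ l₀ → ∀ τ ∈ T K \ Bad K t, Real.exp (Cc K t τ - Rr K t τ) * A K t τ ≤ B K t τ
  /-- upper half of the per-term sandwich -/
  upper : ∀ K t, |t| ≤ l₀ → ∀ τ ∈ T K \ Bad K t, B K t τ ≤ Real.exp (Cc K t τ + Rr K t τ) * A K t τ
  /-- NE-R1 (β): the UV constant is one number `ν K` per cutoff, up to recent-dof deviations `vol·s₂ K` -/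
  uv_const : ∀ K t, |t| ≤ l₀ → ∀ τ ∈ T K \ Bad K t, |Cc K t τ - (CcRec K t τ + ν K)| ≤ vol * s₂ K
  /-- the radius splits: recent factors + REMNANT leaves + NE-R1 (γ) per unit volume -/
  uv_radius : ∀ K t, |t| ≤ l₀ → ∀ τ ∈ T K \ Bad K t, Rr K t τ ≤ RrRec K t τ + RrRem K t τ + vol * u K
  /-- the recent factors' radius per unit volume (rows T4-U5.E-b / E-c), remnants EXCLUDED -/
  recent_remainder : ∀ K t, |t| ≤ l₀ → ∀ τ ∈ T K \ Bad K t, RrRec K t τ ≤ vol * r K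
  /-- H-U5b-1 on recent dof with a `t`-free class constant (O-b3, O-b4) -/
  recent_deviation : ∀ K t, |t| ≤ l₀ → ∀ τ ∈ T K \ Bad K t, |CcRec K t τ - c₀ K| ≤ vol * s K

/-- **REPACKAGING.**  A split budget whose remnant radius is bounded per good term by a YOUNG-booked plus an OLD-booked
rate, `RrRem ≤ vol·rY K + vol·rO K`, is a `ReindexedBudget` with the young rate joined to the recent remainder
(`RrRec + vol·rY`, rate `r + rY`) and the old rate joined to the UV radius (rate `u + rO`) — EXACTLY the budget binder
`hTB` of `T4MatchingClosureRem.hybridNE7_closure_remnantW` when `rY = C_y·remnantYoungW θ Λ C W`,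
`rO = remnantOld remOld Λ C C′`. [folklore] -/
theorem RemnantSplitBudget.reindexed (h : RemnantSplitBudget l₀ vol T A B Bad Cc Rr CcRec RrRec RrRem ν u s₂ c₀ r s)
    (hrem : ∀ K t, |t| ≤ l₀ → ∀ τ ∈ T K \ Bad K t, RrRem K t τ ≤ vol * rY K + vol * rO K) :
    ReindexedBudget l₀ vol T A B Bad Cc Rr CcRec (fun K t τ => RrRec K t τ + vol * rY K) ν (fun K => u K + rO K) s₂
      c₀ (fun K => r K + rY K) s where
  nonneg := h.nonneg
  lower := h.lower
  upper := h.upper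
  uv_const := h.uv_const
  uv_radius K t ht τ hτ := by
    have h1 := h.uv_radius K t ht τ hτ
    have h2 := hrem K t ht τ hτ
    show Rr K t τ ≤ (RrRec K t τ + vol * rY K) + vol * (u K + rO K)
    rw [mul_add]
    linarith
  recent_remainder K t ht τ hτ := by
    have h1 := h.recent_remainder K t ht τ hτ
    show RrRec K t τ + vol * rY K ≤ vol * (r K + rY K)
    rw [mul_add]
    linarith
  recent_deviation := h.recent_deviation

/-- Conversely a `ReindexedBudget` is a split budget with NO remnant radius (`RrRem = 0`): the split shape refines, and
does not strengthen, the consumer's. [folklore] -/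
theorem RemnantSplitBudget.of_reindexed {u' r' : ℕ → ℝ}
    (h : ReindexedBudget l₀ vol T A B Bad Cc Rr CcRec RrRec ν u' s₂ c₀ r' s) :
    RemnantSplitBudget l₀ vol T A B Bad Cc Rr CcRec RrRec (fun _ _ _ => 0) ν u' s₂ c₀ r' s where
  nonneg := h.nonneg
  lower := h.lower
  upper := h.upper
  uv_const := h.uv_const
  uv_radius K t ht τ hτ := by
    have h1 := h.uv_radius K t ht τ hτ
    show Rr K t τ ≤ RrRec K t τ + 0 + vol * u' K
    linarith
  recent_remainder := h.recent_remainder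
  recent_deviation := h.recent_deviation

end Split

/-! ## §3 The per-term feed from per-step data -/

section Feed

variable {ι : Type*} [DecidableEq ι] {l₀ vol : ℝ} {T : ℕ → Finset ι} {A B : ℕ → ℝ → ι → ℝ}
  {Bad : ℕ → ℝ → Finset ι} {Cc Rr CcRec RrRec RrRem : ℕ → ℝ → ι → ℝ} {ν u s₂ c₀ r s : ℕ → ℝ}
  {Λ C C' θ ρ E Cr : ℝ} {W : ℕ → ℕ}

/-- **PER TERM FROM PER STEP.**  If every good term's remnant radius is a window sum of step shares obeying a
`StepBudget` with ONE amplitude `E ≥ 0` and ONE rate constant `C_r` (uniform in the term and the cutoff; `ρ ≥ 0`), the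
remnant clause holds with the young-booked rate `(E·C_r)·remnantYoungW θ Λ C W` and the old-booked rate
`remnantOld (fun _ n ↦ 2Eρⁿ) Λ C C′`. [folklore] -/
theorem remnant_of_steps (hE : 0 ≤ E) (hρ : 0 ≤ ρ)
    (hsteps : ∀ K t, |t| ≤ l₀ → ∀ τ ∈ T K \ Bad K t, ∃ rad ry Qy Qo : ℕ → ℝ,
      StepBudget C C' θ ρ E Cr vol Λ W K rad ry Qy Qo ∧ RrRem K t τ ≤ ∑ j ∈ Icc (jlogOf C K) K, rad j) :
    ∀ K t, |t| ≤ l₀ → ∀ τ ∈ T K \ Bad K t,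
      RrRem K t τ ≤ vol * ((E * Cr) * remnantYoungW θ Λ C W K) +
        vol * remnantOld (fun _ n => 2 * E * ρ ^ n) Λ C C' K := by
  intro K t ht τ hτ
  obtain ⟨rad, ry, Qy, Qo, hSB, hle⟩ := hsteps K t ht τ hτ
  exact hle.trans (hSB.sum_le hE hρ)

/-- … hence **THE `ReindexedBudget` OF THE CLOSURE FROM A SPLIT BUDGET AND PER-STEP DATA**, with
`C_y = E·C_r`, `remOld = (fun _ n ↦ 2Eρⁿ)`. [folklore] -/
theorem reindexedBudget_of_steps (h : RemnantSplitBudget l₀ vol T A B Bad Cc Rr CcRec RrRec RrRem ν u s₂ c₀ r s)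
    (hE : 0 ≤ E) (hρ : 0 ≤ ρ)
    (hsteps : ∀ K t, |t| ≤ l₀ → ∀ τ ∈ T K \ Bad K t, ∃ rad ry Qy Qo : ℕ → ℝ,
      StepBudget C C' θ ρ E Cr vol Λ W K rad ry Qy Qo ∧ RrRem K t τ ≤ ∑ j ∈ Icc (jlogOf C K) K, rad j) :
    ReindexedBudget l₀ vol T A B Bad Cc Rr CcRec
      (fun K t τ => RrRec K t τ + vol * ((E * Cr) * remnantYoungW θ Λ C W K)) ν
      (fun K => u K + remnantOld (fun _ n => 2 * E * ρ ^ n) Λ C C' K) s₂ c₀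
      (fun K => r K + (E * Cr) * remnantYoungW θ Λ C W K) s :=
  h.reindexed (rY := fun K => (E * Cr) * remnantYoungW θ Λ C W K)
    (rO := fun K => remnantOld (fun _ n => 2 * E * ρ ^ n) Λ C C' K) (remnant_of_steps hE hρ hsteps)

/-- The old profile fed this way is the SATURATING `RemnantAgeBound (fun _ n ↦ 2Eρⁿ) (2E) ρ`
(`T4RemnantBooking.remnantAgeBound_saturated`; the shape of pv05's `remnantAgeBound_oldSummand`, by shape). [folklore] -/
theorem remnantAgeBound_fed (hE : 0 ≤ E) (hρ : 0 ≤ ρ) :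
    RemnantAgeBound (fun _ n => 2 * E * ρ ^ n) (2 * E) ρ :=
  remnantAgeBound_saturated (by positivity) hρ

end Feed

/-! ## §4 The closure FED: split budget + remnant clause in, `HybridNE7` out -/

section ClosureFed

variable {ι : Type*} [DecidableEq ι] {l₀ vol : ℝ} {T : ℕ → Finset ι} {A B Acore Bcore : ℕ → ℝ → ι → ℝ}
  {Bad : ℕ → ℝ → Finset ι} {Cc Rr CcRec RrRec RrRem : ℕ → ℝ → ι → ℝ} {ν u' s₂ c₀ r' s L : ℕ → ℝ}
  {remOld : ℕ → ℕ → ℝ} {Λ C' E₀ ρ θ Cy E Cr : ℝ} {W : ℕ → ℕ}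

/-- **THE NODE-U5 CLOSURE, REMNANT RADIUS SPLIT OFF** (= `T4MatchingClosureRem.hybridNE7_closure_remnantW` with the ONE
budget binder `hTB` replaced by the producer-facing pair: `hSB : RemnantSplitBudget … u′ s₂ c₀ r′ s` (seven clauses,
remnants excluded from `u′`, `r′`) and the remnant clause `hsplit : RrRem ≤ vol·(C_y·remnantYoungW θ Λ C W K) +
vol·remnantOld remOld Λ C C′ K` per good term).  Every other binder and the conclusion are those of
`hybridNE7_closure_remnantW`, letter for letter.  CONDITIONAL exactly as that theorem; nothing PRINTED is asserted.
[folklore] -/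
theorem hybridNE7_closure_fed {r₀ V C : ℝ} (h0 : 0 < r₀) (h1 : r₀ < 1) (hV : 0 ≤ V) (hC : 1 < C * (-Real.log r₀))
    (hA : ∀ K t, |t| ≤ l₀ → ∀ τ ∈ T K, 0 ≤ A K t τ) (hB : ∀ K t, |t| ≤ l₀ → ∀ τ ∈ T K, 0 ≤ B K t τ)
    (hDA : SlotDom l₀ T A Bad fun K => V * r₀ ^ (K - jlogOf C K))
    (hDB : SlotDom l₀ T B Bad fun K => V * r₀ ^ (K - jlogOf C K))
    (hL0 : ∀ K, 0 ≤ L K) (hLs : Summable L)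
    (hA0 : ∀ K t, |t| ≤ l₀ → ∀ τ ∈ T K, 0 ≤ Acore K t τ)
    (hAlo : ∀ K t, |t| ≤ l₀ → ∀ τ ∈ T K, Acore K t τ ≤ A K t τ)
    (hAhi : ∀ K t, |t| ≤ l₀ → ∀ τ ∈ T K, A K t τ ≤ Real.exp (L K) * Acore K t τ)
    (hB0 : ∀ K t, |t| ≤ l₀ → ∀ τ ∈ T K, 0 ≤ Bcore K t τ)
    (hBlo : ∀ K t, |t| ≤ l₀ → ∀ τ ∈ T K, Bcore K t τ ≤ B K t τ)
    (hBhi : ∀ K t, |t| ≤ l₀ → ∀ τ ∈ T K, B K t τ ≤ Real.exp (L K) * Bcore K t τ)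
    (hRem : RemnantAgeBound remOld E₀ ρ) (hΛ : 1 ≤ Λ) (hE : 0 ≤ E₀) (hρ0 : 0 < ρ) (hρ1 : ρ < 1)
    (hq : ((⌈C * Real.log Λ⌉₊ : ℕ) : ℝ) + 3 ≤ C' * (-Real.log ρ)) (hθ : 0 < θ) (hθ1 : θ < 1) (hW : SublinearWindow W)
    (hSB : RemnantSplitBudget l₀ vol T Acore Bcore Bad Cc Rr CcRec RrRec RrRem ν u' s₂ c₀ r' s)
    (hsplit : ∀ K t, |t| ≤ l₀ → ∀ τ ∈ T K \ Bad K t,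
      RrRem K t τ ≤ vol * (Cy * remnantYoungW θ Λ C W K) + vol * remnantOld remOld Λ C C' K)
    (hr : Summable r') (hu : Summable u') (hs : Summable s) (hs₂ : Summable s₂) :
    ∃ K₀, HybridNE7 l₀ vol (fun K => T (K₀ + K)) (fun K => A (K₀ + K)) (fun K => B (K₀ + K)) (fun K => Bad (K₀ + K))
      (fun K => 1 - Real.exp (-(V * r₀ ^ (K₀ + K - jlogOf C (K₀ + K)))))
      (fun K t τ => A (K₀ + K) t τ - Acore (K₀ + K) t τ) (fun K t τ => B (K₀ + K) t τ - Bcore (K₀ + K) t τ)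
      (fun K => 1 - Real.exp (-L (K₀ + K)))
      (fun K => ((r' (K₀ + K) + Cy * remnantYoungW θ Λ C W (K₀ + K)) +
          (u' (K₀ + K) + remnantOld remOld Λ C C' (K₀ + K))) + (s (K₀ + K) + s₂ (K₀ + K))) :=
  hybridNE7_closure_remnantW h0 h1 hV hC hA hB hDA hDB hL0 hLs hA0 hAlo hAhi hB0 hBlo hBhi hRem hΛ hE hρ0 hρ1 hq hθ hθ1
    hW (hSB.reindexed (rY := fun K => Cy * remnantYoungW θ Λ C W K) (rO := fun K => remnantOld remOld Λ C C' K) hsplit)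
    hr hu hs hs₂

/-- **THE NODE-U5 CLOSURE FED FROM PER-STEP DATA** (= `hybridNE7_closure_fed` with the remnant clause AND the old profile
discharged from `StepBudget`s: `hsteps` supplies, per good term, step shares with ONE amplitude `E ≥ 0` and ONE rate
constant `C_r`; then `C_y = E·C_r`, `remOld = (fun _ n ↦ 2Eρⁿ)`, `E₀ = 2E` and `hRem` is `remnantAgeBound_fed`).  The
user-facing remnant binders are now: `1 ≤ Λ`, `0 ≤ E`, `0 < ρ < 1`, `⌈C log Λ⌉₊ + 3 ≤ C′(−log ρ)`, `0 < θ < 1`,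
`SublinearWindow W`, and `hsteps`.  CONDITIONAL; nothing PRINTED is asserted. [folklore] -/
theorem hybridNE7_closure_fed_steps {r₀ V C : ℝ} (h0 : 0 < r₀) (h1 : r₀ < 1) (hV : 0 ≤ V)
    (hC : 1 < C * (-Real.log r₀))
    (hA : ∀ K t, |t| ≤ l₀ → ∀ τ ∈ T K, 0 ≤ A K t τ) (hB : ∀ K t, |t| ≤ l₀ → ∀ τ ∈ T K, 0 ≤ B K t τ)
    (hDA : SlotDom l₀ T A Bad fun K => V * r₀ ^ (K - jlogOf C K))
    (hDB : SlotDom l₀ T B Bad fun K => V * r₀ ^ (K - jlogOf C K))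
    (hL0 : ∀ K, 0 ≤ L K) (hLs : Summable L)
    (hA0 : ∀ K t, |t| ≤ l₀ → ∀ τ ∈ T K, 0 ≤ Acore K t τ)
    (hAlo : ∀ K t, |t| ≤ l₀ → ∀ τ ∈ T K, Acore K t τ ≤ A K t τ)
    (hAhi : ∀ K t, |t| ≤ l₀ → ∀ τ ∈ T K, A K t τ ≤ Real.exp (L K) * Acore K t τ)
    (hB0 : ∀ K t, |t| ≤ l₀ → ∀ τ ∈ T K, 0 ≤ Bcore K t τ)
    (hBlo : ∀ K t, |t| ≤ l₀ → ∀ τ ∈ T K, Bcore K t τ ≤ B K t τ)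
    (hBhi : ∀ K t, |t| ≤ l₀ → ∀ τ ∈ T K, B K t τ ≤ Real.exp (L K) * Bcore K t τ)
    (hΛ : 1 ≤ Λ) (hE : 0 ≤ E) (hρ0 : 0 < ρ) (hρ1 : ρ < 1)
    (hq : ((⌈C * Real.log Λ⌉₊ : ℕ) : ℝ) + 3 ≤ C' * (-Real.log ρ)) (hθ : 0 < θ) (hθ1 : θ < 1) (hW : SublinearWindow W)
    (hSB : RemnantSplitBudget l₀ vol T Acore Bcore Bad Cc Rr CcRec RrRec RrRem ν u' s₂ c₀ r' s)
    (hsteps : ∀ K t, |t| ≤ l₀ → ∀ τ ∈ T K \ Bad K t, ∃ rad ry Qy Qo : ℕ → ℝ,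
      StepBudget C C' θ ρ E Cr vol Λ W K rad ry Qy Qo ∧ RrRem K t τ ≤ ∑ j ∈ Icc (jlogOf C K) K, rad j)
    (hr : Summable r') (hu : Summable u') (hs : Summable s) (hs₂ : Summable s₂) :
    ∃ K₀, HybridNE7 l₀ vol (fun K => T (K₀ + K)) (fun K => A (K₀ + K)) (fun K => B (K₀ + K)) (fun K => Bad (K₀ + K))
      (fun K => 1 - Real.exp (-(V * r₀ ^ (K₀ + K - jlogOf C (K₀ + K)))))
      (fun K t τ => A (K₀ + K) t τ - Acore (K₀ + K) t τ) (fun K t τ => B (K₀ + K) t τ - Bcore (K₀ + K) t τ)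
      (fun K => 1 - Real.exp (-L (K₀ + K)))
      (fun K => ((r' (K₀ + K) + (E * Cr) * remnantYoungW θ Λ C W (K₀ + K)) +
          (u' (K₀ + K) + remnantOld (fun _ n => 2 * E * ρ ^ n) Λ C C' (K₀ + K))) + (s (K₀ + K) + s₂ (K₀ + K))) :=
  hybridNE7_closure_fed h0 h1 hV hC hA hB hDA hDB hL0 hLs hA0 hAlo hAhi hB0 hBlo hBhi (remnantAgeBound_fed hE hρ0.le) hΛ
    (by positivity) hρ0 hρ1 hq hθ hθ1 hW hSB (remnant_of_steps hE hρ0.le hsteps) hr hu hs hs₂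

end ClosureFed

/-! ## §4b Per string, end to end, FED -/

section SchemeFed

open Missing T4Continuum T4Assembly

variable {G : Type*} [GaugeGroup G] [MeasurableSpace G] [HaarData G] {O : Type*}

/-- **PER STRING, END TO END, REMNANT RADIUS SPLIT OFF** (= `T4MatchingClosureRem.stringHybridNE7_closure_remnantW` with
`hTB` replaced by `hSB : RemnantSplitBudget …` + the remnant clause `hsplit`).  USER-FACING BINDER LIST OF NODE U5 after
this module: as in `stringHybridNE7_closure_remnantW`, the budget binder now being the split shape (seven clauses,
remnants excluded) plus ONE remnant clause per good term. [folklore] -/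
theorem stringHybridNE7_closure_fed (S : TorusScheme G O) (os : List O) (K₀ : ℕ) {ι : Type} [DecidableEq ι]
    {l₀ vol : ℝ} {T : ℕ → Finset ι} {A B Acore Bcore : ℕ → ℝ → ι → ℝ} {Bad : ℕ → ℝ → Finset ι}
    {Cc Rr CcRec RrRec RrRem : ℕ → ℝ → ι → ℝ} {ν u' s₂ c₀ r' s L : ℕ → ℝ} {remOld : ℕ → ℕ → ℝ}
    {Λ C' E₀ ρ θ Cy : ℝ} {W : ℕ → ℕ} {r₀ V C : ℝ}
    (h0 : 0 < r₀) (h1 : r₀ < 1) (hV : 0 ≤ V) (hC : 1 < C * (-Real.log r₀))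
    (hA : ∀ K t, |t| ≤ l₀ → ∀ τ ∈ T K, 0 ≤ A K t τ) (hB : ∀ K t, |t| ≤ l₀ → ∀ τ ∈ T K, 0 ≤ B K t τ)
    (hDA : SlotDom l₀ T A Bad fun K => V * r₀ ^ (K - jlogOf C K))
    (hDB : SlotDom l₀ T B Bad fun K => V * r₀ ^ (K - jlogOf C K))
    (hL0 : ∀ K, 0 ≤ L K) (hLs : Summable L)
    (hA0 : ∀ K t, |t| ≤ l₀ → ∀ τ ∈ T K, 0 ≤ Acore K t τ)
    (hAlo : ∀ K t, |t| ≤ l₀ → ∀ τ ∈ T K, Acore K t τ ≤ A K t τ)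
    (hAhi : ∀ K t, |t| ≤ l₀ → ∀ τ ∈ T K, A K t τ ≤ Real.exp (L K) * Acore K t τ)
    (hB0 : ∀ K t, |t| ≤ l₀ → ∀ τ ∈ T K, 0 ≤ Bcore K t τ)
    (hBlo : ∀ K t, |t| ≤ l₀ → ∀ τ ∈ T K, Bcore K t τ ≤ B K t τ)
    (hBhi : ∀ K t, |t| ≤ l₀ → ∀ τ ∈ T K, B K t τ ≤ Real.exp (L K) * Bcore K t τ)
    (hRem : RemnantAgeBound remOld E₀ ρ) (hΛ : 1 ≤ Λ) (hE : 0 ≤ E₀) (hρ0 : 0 < ρ) (hρ1 : ρ < 1)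
    (hq : ((⌈C * Real.log Λ⌉₊ : ℕ) : ℝ) + 3 ≤ C' * (-Real.log ρ)) (hθ : 0 < θ) (hθ1 : θ < 1) (hW : SublinearWindow W)
    (hSB : RemnantSplitBudget l₀ vol T Acore Bcore Bad Cc Rr CcRec RrRec RrRem ν u' s₂ c₀ r' s)
    (hsplit : ∀ K t, |t| ≤ l₀ → ∀ τ ∈ T K \ Bad K t,
      RrRem K t τ ≤ vol * (Cy * remnantYoungW θ Λ C W K) + vol * remnantOld remOld Λ C C' K)
    (hr : Summable r') (hu : Summable u') (hs : Summable s) (hs₂ : Summable s₂)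
    (hZA : ∀ K t, |t| ≤ l₀ → T4GenFunBounds.schemeZ S os (K₀ + K) t = ∑ τ ∈ T K, A K t τ)
    (hZB : ∀ K t, |t| ≤ l₀ → T4GenFunBounds.schemeZ S os (K₀ + K + 1) t = ∑ τ ∈ T K, B K t τ) :
    ∃ K₁, StringHybridNE7 S os l₀ vol (K₀ + K₁) :=
  stringHybridNE7_closure_remnantW S os K₀ h0 h1 hV hC hA hB hDA hDB hL0 hLs hA0 hAlo hAhi hB0 hBlo hBhi hRem hΛ hE hρ0
    hρ1 hq hθ hθ1 hW
    (hSB.reindexed (rY := fun K => Cy * remnantYoungW θ Λ C W K) (rO := fun K => remnantOld remOld Λ C C' K) hsplit)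
    hr hu hs hs₂ hZA hZB

/-- **PER STRING, END TO END, FED FROM PER-STEP DATA** (`C_y = E·C_r`, `remOld = (fun _ n ↦ 2Eρⁿ)`, `E₀ = 2E`).
[folklore] -/
theorem stringHybridNE7_closure_fed_steps (S : TorusScheme G O) (os : List O) (K₀ : ℕ) {ι : Type} [DecidableEq ι]
    {l₀ vol : ℝ} {T : ℕ → Finset ι} {A B Acore Bcore : ℕ → ℝ → ι → ℝ} {Bad : ℕ → ℝ → Finset ι}
    {Cc Rr CcRec RrRec RrRem : ℕ → ℝ → ι → ℝ} {ν u' s₂ c₀ r' s L : ℕ → ℝ}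
    {Λ C' ρ θ E Cr : ℝ} {W : ℕ → ℕ} {r₀ V C : ℝ}
    (h0 : 0 < r₀) (h1 : r₀ < 1) (hV : 0 ≤ V) (hC : 1 < C * (-Real.log r₀))
    (hA : ∀ K t, |t| ≤ l₀ → ∀ τ ∈ T K, 0 ≤ A K t τ) (hB : ∀ K t, |t| ≤ l₀ → ∀ τ ∈ T K, 0 ≤ B K t τ)
    (hDA : SlotDom l₀ T A Bad fun K => V * r₀ ^ (K - jlogOf C K))
    (hDB : SlotDom l₀ T B Bad fun K => V * r₀ ^ (K - jlogOf C K))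
    (hL0 : ∀ K, 0 ≤ L K) (hLs : Summable L)
    (hA0 : ∀ K t, |t| ≤ l₀ → ∀ τ ∈ T K, 0 ≤ Acore K t τ)
    (hAlo : ∀ K t, |t| ≤ l₀ → ∀ τ ∈ T K, Acore K t τ ≤ A K t τ)
    (hAhi : ∀ K t, |t| ≤ l₀ → ∀ τ ∈ T K, A K t τ ≤ Real.exp (L K) * Acore K t τ)
    (hB0 : ∀ K t, |t| ≤ l₀ → ∀ τ ∈ T K, 0 ≤ Bcore K t τ)
    (hBlo : ∀ K t, |t| ≤ l₀ → ∀ τ ∈ T K, Bcore K t τ ≤ B K t τ)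
    (hBhi : ∀ K t, |t| ≤ l₀ → ∀ τ ∈ T K, B K t τ ≤ Real.exp (L K) * Bcore K t τ)
    (hΛ : 1 ≤ Λ) (hE : 0 ≤ E) (hρ0 : 0 < ρ) (hρ1 : ρ < 1)
    (hq : ((⌈C * Real.log Λ⌉₊ : ℕ) : ℝ) + 3 ≤ C' * (-Real.log ρ)) (hθ : 0 < θ) (hθ1 : θ < 1) (hW : SublinearWindow W)
    (hSB : RemnantSplitBudget l₀ vol T Acore Bcore Bad Cc Rr CcRec RrRec RrRem ν u' s₂ c₀ r' s)
    (hsteps : ∀ K t, |t| ≤ l₀ → ∀ τ ∈ T K \ Bad K t, ∃ rad ry Qy Qo : ℕ → ℝ,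
      StepBudget C C' θ ρ E Cr vol Λ W K rad ry Qy Qo ∧ RrRem K t τ ≤ ∑ j ∈ Icc (jlogOf C K) K, rad j)
    (hr : Summable r') (hu : Summable u') (hs : Summable s) (hs₂ : Summable s₂)
    (hZA : ∀ K t, |t| ≤ l₀ → T4GenFunBounds.schemeZ S os (K₀ + K) t = ∑ τ ∈ T K, A K t τ)
    (hZB : ∀ K t, |t| ≤ l₀ → T4GenFunBounds.schemeZ S os (K₀ + K + 1) t = ∑ τ ∈ T K, B K t τ) :
    ∃ K₁, StringHybridNE7 S os l₀ vol (K₀ + K₁) :=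
  stringHybridNE7_closure_fed S os K₀ h0 h1 hV hC hA hB hDA hDB hL0 hLs hA0 hAlo hAhi hB0 hBlo hBhi
    (remnantAgeBound_fed hE hρ0.le) hΛ (by positivity) hρ0 hρ1 hq hθ hθ1 hW hSB (Cy := E * Cr)
    (remnant_of_steps hE hρ0.le hsteps) hr hu hs hs₂ hZA hZB

end SchemeFed

/-! ## §5 Sanity: the shapes are inhabited and the feed fires -/

section Sanity

/-- SANITY (non-vacuity of `RemnantSplitBudget`): one good term per cutoff, `A = B = 1`, every constant, radius and rate
`0`. [folklore] -/
theorem remnantSplitBudget_trivial (l₀ vol : ℝ) :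
    RemnantSplitBudget l₀ vol (fun _ => ({()} : Finset Unit)) (fun _ _ _ => 1) (fun _ _ _ => 1) (fun _ _ => ∅)
      (fun _ _ _ => 0) (fun _ _ _ => 0) (fun _ _ _ => 0) (fun _ _ _ => 0) (fun _ _ _ => 0) (fun _ => 0) (fun _ => 0)
      (fun _ => 0) (fun _ => 0) (fun _ => 0) (fun _ => 0) where
  nonneg _ _ _ _ _ := zero_le_one
  lower _ _ _ _ _ := by simp
  upper _ _ _ _ _ := by simp
  uv_const _ _ _ _ _ := by simp
  uv_radius _ _ _ _ _ := by simp
  recent_remainder _ _ _ _ _ := by simp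
  recent_deviation _ _ _ _ _ := by simp

/-- SANITY (the feed fires on the trivial split budget with the ZERO step data, `vol, Λ, θ, ρ, C_r ≥ 0`):
`reindexedBudget_of_steps` yields a `ReindexedBudget` whose remnant rates are the fed ones with `E = 0`. [folklore] -/
example (l₀ C C' : ℝ) {vol Λ θ ρ Cr : ℝ} (hvol : 0 ≤ vol) (hΛ : 0 ≤ Λ) (hθ : 0 ≤ θ) (hρ : 0 ≤ ρ) (hCr : 0 ≤ Cr)
    (W : ℕ → ℕ) :
    ReindexedBudget l₀ vol (fun _ => ({()} : Finset Unit)) (fun _ _ _ => 1) (fun _ _ _ => 1) (fun _ _ => ∅)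
      (fun _ _ _ => 0) (fun _ _ _ => 0) (fun _ _ _ => 0)
      (fun K _ _ => (0 : ℝ) + vol * ((0 * Cr) * remnantYoungW θ Λ C W K)) (fun _ => 0)
      (fun K => (0 : ℝ) + remnantOld (fun _ n => 2 * 0 * ρ ^ n) Λ C C' K) (fun _ => 0) (fun _ => 0)
      (fun K => (0 : ℝ) + (0 * Cr) * remnantYoungW θ Λ C W K) (fun _ => 0) :=
  reindexedBudget_of_steps (remnantSplitBudget_trivial l₀ vol) le_rfl hρ fun K _ _ _ _ =>
    ⟨fun _ => 0, fun _ => 0, fun _ => 0, fun _ => 0,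
      ⟨fun _ _ => ⟨le_rfl, by positivity⟩, fun _ _ => ⟨le_rfl, by positivity⟩, fun _ _ => by positivity,
        fun _ _ => by simp⟩, by simp⟩

/-- SANITY (the fed remnant binders are jointly satisfiable): for any `E ≥ 0`, `0 < ρ < 1`, `C`, `Λ` there is an
age-cut constant `C′ ≥ 0` with `hq`, and the fed old profile is an admissible `RemnantAgeBound`. [folklore] -/
theorem fedBinders_satisfiable {E ρ : ℝ} (hE : 0 ≤ E) (hρ0 : 0 < ρ) (hρ1 : ρ < 1) (C Λ : ℝ) :
    ∃ C' : ℝ, 0 ≤ C' ∧ RemnantAgeBound (fun _ n => 2 * E * ρ ^ n) (2 * E) ρ ∧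
      ((⌈C * Real.log Λ⌉₊ : ℕ) : ℝ) + 3 ≤ C' * (-Real.log ρ) := by
  obtain ⟨C', hC', hq⟩ := exists_ageCutConst hρ0 hρ1 C Λ
  exact ⟨C', hC', remnantAgeBound_fed hE hρ0.le, hq⟩

end Sanity

end Literature.MathematicalPhysics.QuantumFieldTheory.Balaban1983to89.T4MatchingClosureFed
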